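import Summits.Ventures.CertifiedManyBodySolver.Downfold.BoxesLa214TpLadderSigmaFSSubBoxes
import Summits.Ventures.CertifiedManyBodySolver.Downfold.EmeryFermiFillingLSCO
import HarnessLib

/-!
# `t′` ladder of La₂₋ₓSrₓCuO₄ (box #18), part 4c (ties): the raw-coordinate WORDS on the Δ_pd × t_pd eighths of the 3BE companion that carry part 4c's
# statements — the three MEMBER-FREE eighths, the three ALL-E eighths, the one x = 1/8 eighth that misses a located member — tied BY NAME to mod-4's
# sub-box certificates `Emery.la214Sub_i_j` / `Emery.lscoSub_i_j`

Venture CertifiedManyBodySolver, cell `pub/hubbard-downfold` (D-0154 (1)(C) COVERAGE, La214 TEMPLATE material; seat `hubbard-cov-la214-unc-3`, seventh seat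
(`prover-hubbard-cov-la214-unc-3-g6-0`), lane `t′`); namespace `Summit.Ventures.CertifiedManyBodySolver.Downfold`. Split off part 4c
(`BoxesLa214TpLadderSigmaFSSubBoxes`, whose typed table `la214_M13_tp_sigmaFS_subWindows` / `la214_M15_tp_sigmaFS_subWindows` lists the 16 + 16 certified windows)
only because it must import the device's files; everything here is PROVED, each word being ONE application of a mod-4 sub-box theorem followed by part 4c's /
part 1's typed facts. Coordinates raw: (Δ, tpd, tpp, c) = (Δ_pd, t_pd, t_pp, t_pp′) in eV, `ε` a Fermi energy, `Emery.abFilling … ε` the σ-model antibonding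
per-spin filling (x = 0: ∈ [99/200, 101/200]; x = 1/8: ∈ [171/400, 179/400]), `Emery.fsRatio … ε` the exact `t′/t` of the Fermi contour.

* §1 THE THREE MEMBER-FREE EIGHTHS at n = 1 — Δ_pd ∈ [3.425, 3.7125] × t_pd ∈ [1.405, 1.52] (`la214Sub_6_1`), Δ_pd ∈ [3.7125, 4.0] × t_pd ∈ [1.29, 1.405]
  (`la214Sub_7_0`), Δ_pd ∈ [3.7125, 4.0] × t_pd ∈ [1.405, 1.52] (`la214Sub_7_1`): the σ-model FS ratio lies strictly ABOVE the in-house member hull's weak end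
  `−119/500`, hence equals NONE of the twelve located x = 0 object-E refits `la214E_tp_x0_dets` — while still being γ-admissible and (k = 13, 14) an object-E ROW
  value whenever `≤ −1/5`; on the last eighth the ratio lies in the typed window `(−2293/10000, −1653/10000)` that contains the Pavarini end `−17/100`.
* §2 THE THREE ALL-E EIGHTHS — Δ_pd ∈ [1.7, 1.9875] × either t_pd half (`la214Sub_0_0`, `la214Sub_0_1`), Δ_pd ∈ [1.9875, 2.275] × t_pd-low (`la214Sub_1_0`): every
  σ-model FS ratio at n = 1 IS a value of the E row of record `la214E_M13v19_tp` (and lies in a window containing all twelve located members).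
* §3 x = 1/8, Δ_pd ∈ [1.7, 1.9875] × t_pd-low (`lscoSub_0_0`): the ratio is `≤ −2147/10000`, so it is NOT the located x = 1/8 member `−213/1000` (it can be
  `−9/40`); it is an M15 E-row value.
HONEST FRAMING: SCREENING-GRADE companion box; REDUCTION STEP only (mod-4's certificates); «equals none of the located refits» is a statement about typed numbers
on a typed sub-box, not about La₂CuO₄; no row, END, FLOOR, word, bar, leaf, node or coverage statement moves; no phase sentence; no summit statement is proved by
this seat. References: three-band model [HybertsenSchluterChristensen1989, Eq. (1)].
-/

noncomputable section

namespace Summit.Ventures.CertifiedManyBodySolver.Downfold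

open Set NonemptyInterval

/-! ## §1 The three member-free eighths (x = 0, n = 1) -/

/-- **MEMBER-FREE EIGHTH Δ_pd ∈ [3.425, 3.7125] × t_pd ∈ [1.405, 1.52]** (window k = 13 of part 4c = `Emery.la214Sub_6_1`: `t′/t ∈ [−1181/5000, −1703/10000]`): the
σ-model FS ratio exceeds the member hull's weak end `−119/500` (by ≥ `9/5000`), so it equals none of the twelve located x = 0 refits; it lies in W13 and in the γ
row, and it is an E-ROW value iff `≤ −1/5`. [cite: HybertsenSchluterChristensen1989, Eq. (1) (three-band d–p model)] -/
theorem la214_tp_sigmaFS_memberFree_sub_6_1 {Δ tpd tpp c ε : ℝ} (hΔ : Δ ∈ Set.Icc (137 / 40 : ℝ) (297 / 80 : ℝ))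
    (ha : tpd ∈ Set.Icc (281 / 200 : ℝ) (38 / 25 : ℝ)) (hb : tpp ∈ Set.Icc (23 / 50 : ℝ) (33 / 50 : ℝ)) (hc : c ∈ Set.Icc (3 / 25 : ℝ) (3 / 20 : ℝ))
    (hν : Emery.abFilling Δ tpd tpp c ε ∈ Set.Icc (99 / 200 : ℝ) (101 / 200)) :
    ((la214E_tp_x0_hull.snd : ℚ) : ℝ) + 9/5000 ≤ Emery.fsRatio Δ tpd tpp c ε ∧
      (∀ m ∈ la214E_tp_x0_dets, Emery.fsRatio Δ tpd tpp c ε ≠ ((m : ℚ) : ℝ)) ∧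
      la214_M13_tp_sigmaFS.Mem (Emery.fsRatio Δ tpd tpp c ε) ∧ la214G_tp_row.Mem (Emery.fsRatio Δ tpd tpp c ε) ∧
      (la214E_M13v19_tp.Mem (Emery.fsRatio Δ tpd tpp c ε) ↔ Emery.fsRatio Δ tpd tpp c ε ≤ -(1 / 5 : ℝ)) := by
  obtain ⟨h1, h2⟩ := (Emery.la214Sub_6_1 hΔ ha hb hc hν).2
  have hW : la214_M13_tp_sigmaFS.Mem (Emery.fsRatio Δ tpd tpp c ε) := by
    rw [la214_M13_tp_sigmaFS, Entry.mem_ofEnds_iff']; push_cast; exact ⟨by linarith, by linarith⟩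
  refine ⟨?_, fun m hm heq => ?_, hW, la214_tp_sigmaFS_inside_gamma.1 _ hW, la214_tp_sigmaFS_vs_objectE_row.2.1 _ hW⟩
  · simp only [la214E_tp_x0_hull]; push_cast; linarith
  · obtain ⟨-, hm2⟩ := la214E_tp_x0_dets_mem_hull m hm
    simp only [la214E_tp_x0_hull] at hm2
    have hm2' : ((m : ℚ) : ℝ) ≤ ((-119/500 : ℚ) : ℝ) := by exact_mod_cast hm2
    rw [heq] at h1
    push_cast at hm2'
    linarith

/-- **MEMBER-FREE EIGHTH Δ_pd ∈ [3.7125, 4.0] × t_pd ∈ [1.29, 1.405]** (window k = 14 = `Emery.la214Sub_7_0`: `[−1183/5000, −213/1250]`): the ratio exceeds `−119/500`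
by ≥ `7/5000`, equals none of the twelve located x = 0 refits, lies in W13 and the γ row, and is an E-row value iff `≤ −1/5`.
[cite: HybertsenSchluterChristensen1989, Eq. (1) (three-band d–p model)] -/
theorem la214_tp_sigmaFS_memberFree_sub_7_0 {Δ tpd tpp c ε : ℝ} (hΔ : Δ ∈ Set.Icc (297 / 80 : ℝ) (4 : ℝ))
    (ha : tpd ∈ Set.Icc (129 / 100 : ℝ) (281 / 200 : ℝ)) (hb : tpp ∈ Set.Icc (23 / 50 : ℝ) (33 / 50 : ℝ)) (hc : c ∈ Set.Icc (3 / 25 : ℝ) (3 / 20 : ℝ))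
    (hν : Emery.abFilling Δ tpd tpp c ε ∈ Set.Icc (99 / 200 : ℝ) (101 / 200)) :
    ((la214E_tp_x0_hull.snd : ℚ) : ℝ) + 7/5000 ≤ Emery.fsRatio Δ tpd tpp c ε ∧
      (∀ m ∈ la214E_tp_x0_dets, Emery.fsRatio Δ tpd tpp c ε ≠ ((m : ℚ) : ℝ)) ∧
      la214_M13_tp_sigmaFS.Mem (Emery.fsRatio Δ tpd tpp c ε) ∧ la214G_tp_row.Mem (Emery.fsRatio Δ tpd tpp c ε) ∧
      (la214E_M13v19_tp.Mem (Emery.fsRatio Δ tpd tpp c ε) ↔ Emery.fsRatio Δ tpd tpp c ε ≤ -(1 / 5 : ℝ)) := by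
  obtain ⟨h1, h2⟩ := (Emery.la214Sub_7_0 hΔ ha hb hc hν).2
  have hW : la214_M13_tp_sigmaFS.Mem (Emery.fsRatio Δ tpd tpp c ε) := by
    rw [la214_M13_tp_sigmaFS, Entry.mem_ofEnds_iff']; push_cast; exact ⟨by linarith, by linarith⟩
  refine ⟨?_, fun m hm heq => ?_, hW, la214_tp_sigmaFS_inside_gamma.1 _ hW, la214_tp_sigmaFS_vs_objectE_row.2.1 _ hW⟩
  · simp only [la214E_tp_x0_hull]; push_cast; linarith
  · obtain ⟨-, hm2⟩ := la214E_tp_x0_dets_mem_hull m hm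
    simp only [la214E_tp_x0_hull] at hm2
    have hm2' : ((m : ℚ) : ℝ) ≤ ((-119/500 : ℚ) : ℝ) := by exact_mod_cast hm2
    rw [heq] at h1
    push_cast at hm2'
    linarith

/-- **MEMBER-FREE EIGHTH Δ_pd ∈ [3.7125, 4.0] × t_pd ∈ [1.405, 1.52]** (window k = 15 = `Emery.la214Sub_7_1`: `[−2293/10000, −1653/10000]`, the weak-end eighth of
the whole companion): the ratio exceeds `−119/500` by ≥ `87/10000`, equals none of the twelve located x = 0 refits, lies in the γ row, is an E-row value iff
`≤ −1/5`, is a literature-object-M-row value (`[−9/50, −3/50]`) iff `≥ −9/50` — and its certified window is the one x = 0 eighth-window that contains the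
Pavarini NMTO end `−17/100` (part 4c §3). [cite: HybertsenSchluterChristensen1989, Eq. (1) (three-band d–p model)] -/
theorem la214_tp_sigmaFS_memberFree_sub_7_1 {Δ tpd tpp c ε : ℝ} (hΔ : Δ ∈ Set.Icc (297 / 80 : ℝ) (4 : ℝ))
    (ha : tpd ∈ Set.Icc (281 / 200 : ℝ) (38 / 25 : ℝ)) (hb : tpp ∈ Set.Icc (23 / 50 : ℝ) (33 / 50 : ℝ)) (hc : c ∈ Set.Icc (3 / 25 : ℝ) (3 / 20 : ℝ))
    (hν : Emery.abFilling Δ tpd tpp c ε ∈ Set.Icc (99 / 200 : ℝ) (101 / 200)) :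
    ((la214E_tp_x0_hull.snd : ℚ) : ℝ) + 87/10000 ≤ Emery.fsRatio Δ tpd tpp c ε ∧
      (∀ m ∈ la214E_tp_x0_dets, Emery.fsRatio Δ tpd tpp c ε ≠ ((m : ℚ) : ℝ)) ∧
      la214_M13_tp_sigmaFS.Mem (Emery.fsRatio Δ tpd tpp c ε) ∧ la214G_tp_row.Mem (Emery.fsRatio Δ tpd tpp c ε) ∧
      (la214E_M13v19_tp.Mem (Emery.fsRatio Δ tpd tpp c ε) ↔ Emery.fsRatio Δ tpd tpp c ε ≤ -(1 / 5 : ℝ)) ∧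
      ((((la214M_tp_lit_row.fst : ℚ) : ℝ) ≤ Emery.fsRatio Δ tpd tpp c ε ∧ Emery.fsRatio Δ tpd tpp c ε ≤ ((la214M_tp_lit_row.snd : ℚ) : ℝ)) ↔
        -(9 / 50 : ℝ) ≤ Emery.fsRatio Δ tpd tpp c ε) ∧
      ((-2293/10000 : ℚ) ≤ -17/100 ∧ (-17/100 : ℚ) ≤ -1653/10000) := by
  obtain ⟨h1, h2⟩ := (Emery.la214Sub_7_1 hΔ ha hb hc hν).2
  have hW : la214_M13_tp_sigmaFS.Mem (Emery.fsRatio Δ tpd tpp c ε) := by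
    rw [la214_M13_tp_sigmaFS, Entry.mem_ofEnds_iff']; push_cast; exact ⟨by linarith, by linarith⟩
  refine ⟨?_, fun m hm heq => ?_, hW, la214_tp_sigmaFS_inside_gamma.1 _ hW, la214_tp_sigmaFS_vs_objectE_row.2.1 _ hW,
    (la214_tp_sigmaFS_vs_objectM.2.1 _ hW).1, by norm_num⟩
  · simp only [la214E_tp_x0_hull]; push_cast; linarith
  · obtain ⟨-, hm2⟩ := la214E_tp_x0_dets_mem_hull m hm
    simp only [la214E_tp_x0_hull] at hm2
    have hm2' : ((m : ℚ) : ℝ) ≤ ((-119/500 : ℚ) : ℝ) := by exact_mod_cast hm2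
    rw [heq] at h1
    push_cast at hm2'
    linarith

/-! ## §2 The three all-E eighths (x = 0, n = 1) -/

/-- **ALL-E EIGHTHS**: on Δ_pd ∈ [1.7, 1.9875] × t_pd ∈ [1.29, 1.405] (`Emery.la214Sub_0_0`, window `[−591/2000, −2129/10000]`), Δ_pd ∈ [1.7, 1.9875] × t_pd ∈
[1.405, 1.52] (`la214Sub_0_1`, `[−2859/10000, −1021/5000]`) and Δ_pd ∈ [1.9875, 2.275] × t_pd ∈ [1.29, 1.405] (`la214Sub_1_0`, `[−1429/5000, −2063/10000]`) EVERY
σ-model Fermi-surface ratio at n = 1 is a value of the object-E row of record `la214E_M13v19_tp = [−3/10, −1/5]` (and of the γ row). Three applications.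
[cite: HybertsenSchluterChristensen1989, Eq. (1) (three-band d–p model)] -/
theorem la214_tp_sigmaFS_allE_subs {Δ tpd tpp c ε : ℝ} (hb : tpp ∈ Set.Icc (23 / 50 : ℝ) (33 / 50 : ℝ)) (hc : c ∈ Set.Icc (3 / 25 : ℝ) (3 / 20 : ℝ))
    (hν : Emery.abFilling Δ tpd tpp c ε ∈ Set.Icc (99 / 200 : ℝ) (101 / 200)) :
    (Δ ∈ Set.Icc (17 / 10 : ℝ) (159 / 80 : ℝ) → tpd ∈ Set.Icc (129 / 100 : ℝ) (281 / 200 : ℝ) →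
        la214E_M13v19_tp.Mem (Emery.fsRatio Δ tpd tpp c ε) ∧ la214G_tp_row.Mem (Emery.fsRatio Δ tpd tpp c ε)) ∧
      (Δ ∈ Set.Icc (17 / 10 : ℝ) (159 / 80 : ℝ) → tpd ∈ Set.Icc (281 / 200 : ℝ) (38 / 25 : ℝ) →
        la214E_M13v19_tp.Mem (Emery.fsRatio Δ tpd tpp c ε) ∧ la214G_tp_row.Mem (Emery.fsRatio Δ tpd tpp c ε)) ∧
      (Δ ∈ Set.Icc (159 / 80 : ℝ) (91 / 40 : ℝ) → tpd ∈ Set.Icc (129 / 100 : ℝ) (281 / 200 : ℝ) →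
        la214E_M13v19_tp.Mem (Emery.fsRatio Δ tpd tpp c ε) ∧ la214G_tp_row.Mem (Emery.fsRatio Δ tpd tpp c ε)) := by
  have keyE : ∀ {r : ℝ}, -(3 / 10 : ℝ) ≤ r → r ≤ -(1 / 5 : ℝ) → la214E_M13v19_tp.Mem r ∧ la214G_tp_row.Mem r := by
    intro r hr1 hr2
    have hE : la214E_M13v19_tp.Mem r := by
      rw [la214E_M13v19_tp, Entry.mem_ofEnds_iff']; push_cast; exact ⟨by linarith, by linarith⟩
    exact ⟨hE, la214G_tp_row_mem_of_E_mem hE⟩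
  refine ⟨fun hΔ ha => ?_, fun hΔ ha => ?_, fun hΔ ha => ?_⟩
  · obtain ⟨h1, h2⟩ := (Emery.la214Sub_0_0 hΔ ha hb hc hν).2
    exact keyE (by linarith) (by linarith)
  · obtain ⟨h1, h2⟩ := (Emery.la214Sub_0_1 hΔ ha hb hc hν).2
    exact keyE (by linarith) (by linarith)
  · obtain ⟨h1, h2⟩ := (Emery.la214Sub_1_0 hΔ ha hb hc hν).2
    exact keyE (by linarith) (by linarith)

/-! ## §3 x = 1/8: the one eighth that misses a located member -/

/-- **x = 1/8, Δ_pd ∈ [1.7, 1.9875] × t_pd ∈ [1.29, 1.405]** (`Emery.lscoSub_0_0`, window `[−741/2500, −2147/10000]`): at the M15 electron count the σ-model FS ratio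
is `≤ −2147/10000`, hence NOT the located x = 1/8 member `−213/1000` (`la214E_tp_x18_dets`; missed by ≥ `17/10000`), while the other member `−9/40` lies in the
window; the ratio is an M15 E-row value (`la214E_M15v19_tp`) and lies in W15. [cite: HybertsenSchluterChristensen1989, Eq. (1) (three-band d–p model)] -/
theorem la214_tp_sigmaFS_M15_sub_0_0 {Δ tpd tpp c ε : ℝ} (hΔ : Δ ∈ Set.Icc (17 / 10 : ℝ) (159 / 80 : ℝ))
    (ha : tpd ∈ Set.Icc (129 / 100 : ℝ) (281 / 200 : ℝ)) (hb : tpp ∈ Set.Icc (23 / 50 : ℝ) (33 / 50 : ℝ)) (hc : c ∈ Set.Icc (3 / 25 : ℝ) (3 / 20 : ℝ))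
    (hν : Emery.abFilling Δ tpd tpp c ε ∈ Set.Icc (171 / 400 : ℝ) (179 / 400)) :
    Emery.fsRatio Δ tpd tpp c ε + 17/10000 ≤ ((-213/1000 : ℚ) : ℝ) ∧ Emery.fsRatio Δ tpd tpp c ε ≠ ((-213/1000 : ℚ) : ℝ) ∧
      ((-213/1000 : ℚ) ∈ la214E_tp_x18_dets ∧ (-9/40 : ℚ) ∈ la214E_tp_x18_dets ∧ (-741/2500 : ℚ) ≤ -9/40 ∧ (-9/40 : ℚ) ≤ -2147/10000) ∧
      la214E_M15v19_tp.Mem (Emery.fsRatio Δ tpd tpp c ε) ∧ la214_M15_tp_sigmaFS.Mem (Emery.fsRatio Δ tpd tpp c ε) := by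
  obtain ⟨h1, h2⟩ := (Emery.lscoSub_0_0 hΔ ha hb hc hν).2
  refine ⟨?_, fun heq => ?_, ⟨by simp [la214E_tp_x18_dets], by simp [la214E_tp_x18_dets], by norm_num, by norm_num⟩, ?_, ?_⟩
  · push_cast; linarith
  · rw [heq] at h2; push_cast at h2; linarith
  · rw [la214E_M15v19_tp, Entry.mem_ofEnds_iff']; push_cast; exact ⟨by linarith, by linarith⟩
  · rw [la214_M15_tp_sigmaFS, Entry.mem_ofEnds_iff']; push_cast; exact ⟨by linarith, by linarith⟩

/-- **One citable line**: on the three member-free eighths of the companion at n = 1 no σ-model Fermi-surface ratio equals a located in-house object-E refit; on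
the three all-E eighths every σ-model ratio is an E-row value. [folklore] -/
theorem la214_tp_sigmaFS_subBoxes_of_certificates {Δ tpd tpp c ε : ℝ} (hb : tpp ∈ Set.Icc (23 / 50 : ℝ) (33 / 50 : ℝ))
    (hc : c ∈ Set.Icc (3 / 25 : ℝ) (3 / 20 : ℝ)) (hν : Emery.abFilling Δ tpd tpp c ε ∈ Set.Icc (99 / 200 : ℝ) (101 / 200)) :
    ((Δ ∈ Set.Icc (137 / 40 : ℝ) (297 / 80 : ℝ) ∧ tpd ∈ Set.Icc (281 / 200 : ℝ) (38 / 25 : ℝ)) ∨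
        (Δ ∈ Set.Icc (297 / 80 : ℝ) (4 : ℝ) ∧ tpd ∈ Set.Icc (129 / 100 : ℝ) (38 / 25 : ℝ)) →
        ∀ m ∈ la214E_tp_x0_dets, Emery.fsRatio Δ tpd tpp c ε ≠ ((m : ℚ) : ℝ)) ∧
      ((Δ ∈ Set.Icc (17 / 10 : ℝ) (159 / 80 : ℝ) ∧ tpd ∈ Set.Icc (129 / 100 : ℝ) (38 / 25 : ℝ)) ∨
        (Δ ∈ Set.Icc (159 / 80 : ℝ) (91 / 40 : ℝ) ∧ tpd ∈ Set.Icc (129 / 100 : ℝ) (281 / 200 : ℝ)) →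
        la214E_M13v19_tp.Mem (Emery.fsRatio Δ tpd tpp c ε)) := by
  refine ⟨fun h => ?_, fun h => ?_⟩
  · rcases h with ⟨hΔ, ha⟩ | ⟨hΔ, ha⟩
    · exact (la214_tp_sigmaFS_memberFree_sub_6_1 hΔ ha hb hc hν).2.1
    · rcases Emery.mem_Icc_split ha (281 / 200 : ℝ) with ha' | ha'
      · exact (la214_tp_sigmaFS_memberFree_sub_7_0 hΔ ha' hb hc hν).2.1
      · exact (la214_tp_sigmaFS_memberFree_sub_7_1 hΔ ha' hb hc hν).2.1
  · rcases h with ⟨hΔ, ha⟩ | ⟨hΔ, ha⟩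
    · rcases Emery.mem_Icc_split ha (281 / 200 : ℝ) with ha' | ha'
      · exact ((la214_tp_sigmaFS_allE_subs hb hc hν).1 hΔ ha').1
      · exact ((la214_tp_sigmaFS_allE_subs hb hc hν).2.1 hΔ ha').1
    · exact ((la214_tp_sigmaFS_allE_subs hb hc hν).2.2 hΔ ha).1

end Summit.Ventures.CertifiedManyBodySolver.Downfold

end
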